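import Summits.HodgeConjecture.HodgeConjecture.Theorems.AnchorTransportVariationalHodgeCurveBase
import Literature.AlgebraicGeometry.Motives.CurveThroughTwoPointsProofs
import Literature.AlgebraicGeometry.Motives.HypersurfaceFieldPoints
import Mathlib.Topology.Connected.Clopen
import Mathlib.AlgebraicGeometry.Noetherian

/-!
# Route AnchorTransport — `VariationalHodge` (stmt-HodgeConjecture-1076): the base hypotheses are idle up to connectedness

The crux `AnchorTransport.VariationalHodge` is Grothendieck's variational Hodge conjecture in global-class
form for smooth projective families `f : 𝒳 ⟶ S` over a SMOOTH IRREDUCIBLE complex base `S`. This file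
proves, unconditionally, that these two base hypotheses carry no content beyond connectedness: the crux
is EQUIVALENT to the same statement over every IRREDUCIBLE base LOCALLY OF FINITE TYPE over `ℂ`
(`variationalHodge_iff_irreducibleBase`) and to the same statement over every (PRE)CONNECTED base locally
of finite type (`variationalHodge_iff_connectedBase`) — singular, non-normal, non-reduced, reducible,
non-separated bases allowed. Over a disconnected base the statement is the Hodge conjecture itself
(`Cruxes/VariationalHodge/Disproof.lean`, `withoutBaseHyps_of_hodgeConjecture` and the remark there), so
connectedness is exactly the load-bearing residue of "smooth irreducible".

Proofs.
* `variationalHodge_conclusion_of_irreducibleBase`: chain the anchor `s₀` to the target `s` through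
  affine opens of the irreducible base (`forall_complexPoints_of_affineOpens`: irreducibility and the
  Jacobson property only). Inside one affine open `U` (irreducible, affine, locally of finite type — no
  smoothness) two distinct complex points lie on the image of a SMOOTH irreducible affine curve
  `g : C ⟶ U` by Mumford's lemma, a THEOREM of the tree (`Motives.mumford_smoothCurve_through_two_points_holds`,
  whose statement asks nothing of the singularities of the ambient scheme); base-change the family along
  `g ≫ (U ↪ S)` and transport hypotheses, anchor and conclusion
  (`variationalHodge_conclusion_of_baseChange`); over the smooth irreducible curve `C` the crux applies.
* `variationalHodge_conclusion_of_isIrreducible_isClosed`: the same inside any irreducible closed subset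
  `Z ⊆ S`, through the reduced closed subscheme `V(𝒥_Z)` (Mathlib `IdealSheafData.vanishingIdeal`,
  complex points lift by `AlgPoints.liftClosed`).
* `variationalHodge_conclusion_of_preconnectedBase`: the set of scheme points over whose closure `A` is
  somewhere algebraic is locally constant in membership — an affine open neighbourhood is a noetherian
  space (`S` is locally noetherian), so after removing its finitely many irreducible components missing
  `x` every nearby point shares an irreducible closed subset with `x` — hence constant on a preconnected
  base (Mathlib `PreconnectedSpace.induction₂'`).

Consequences recorded:
* `variationalHodge_iff_irreducibleBase`, `variationalHodge_iff_connectedBase`;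
* `hodgeConjecture_of_variationalHodge_of_anchors_over_connectedBases` (and `…_irreducibleBases`) — the
  route's assembly with the anchor crux WEAKENED accordingly: granted `VariationalHodge`, it suffices to
  realise every Hodge class, up to isomorphism, as a fibre value of a fibrewise-Hodge global class on a
  smooth projective family over a CONNECTED base locally of finite type (e.g. a connected part of a Hodge
  locus with whatever singularities and components it has) carrying an algebraic anchor — no resolution,
  normalisation or irreducible-component bookkeeping of the base is owed (`IsoInvariance_holds`,
  `HodgeModels_holds` are the tree's closed support items).

HONEST FRAMING: research route conditional on HC_CM; not a corollary; Q11.4-sentence-2 already refuted in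
dim ≥ 3. Nothing here bears on `HC_CM`; no case of the Hodge conjecture and no instance of the crux is
proved — the file removes hypotheses from the crux's statement, both ways.
-/


noncomputable section

-- every declaration of this problem lives in `Summit.HodgeConjecture.HodgeConjecture.…` (summit = sub-problem)
set_option linter.dupNamespace false

open CategoryTheory AlgebraicGeometry TopologicalSpace
open Literature.AlgebraicGeometry.Motives Literature.AlgebraicGeometry.HodgeTheory
open Summit.HodgeConjecture.HodgeConjecture.Theses.AnchorTransport

namespace Summit.HodgeConjecture.HodgeConjecture.Theorems

/-! ### One step inside an affine open of an irreducible base (no smoothness) -/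

/-- **One step inside an affine open, base smoothness dropped.** Granted the crux `VariationalHodge`, for
a smooth projective family over an IRREDUCIBLE `ℂ`-scheme locally of finite type and a fibrewise rational
`(p,p)` global class `A`, algebraicity of `A|_{𝒳_a}` passes to `A|_{𝒳_b}` whenever `pt a`, `pt b` lie in a
common affine open `U`: lift `a`, `b` to the open subscheme `U` (affine, irreducible, locally of finite
type), join them by a smooth irreducible affine curve `g : C ⟶ U` (Mumford's lemma, the tree's theorem
`mumford_smoothCurve_through_two_points_holds` — no hypothesis on the singularities of `U`), and transport
along the base change by `g ≫ (U ↪ S)` (`variationalHodge_conclusion_of_baseChange`), applying the crux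
over the smooth irreducible curve `C`. -/
theorem variationalHodge_step_of_irreducibleBase (hV : VariationalHodge) {n : ℕ} {𝒳 S : SchemeOver ℂ}
    (f : 𝒳 ⟶ S) (hf : IsSmoothProjectiveFamily f n) [IrreducibleSpace S.left]
    [LocallyOfFiniteType S.hom] (p : ℕ) (A : complexBetti 𝒳 (2 * p))
    (hA : ∀ s : ComplexPoints S, IsRationalClass (complexBetti.map (fiberι f s) (2 * p) A) ∧
      IsOfHodgeType n (fiberOver f s) (2 * p) p p (complexBetti.map (fiberι f s) (2 * p) A))
    (U : S.left.Opens) (hU : IsAffineOpen U) (a b : ComplexPoints S) (haU : a.pt ∈ U) (hbU : b.pt ∈ U)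
    (ha : complexBetti.map (fiberι f a) (2 * p) A ∈ algebraicClasses (fiberOver f a) p) :
    complexBetti.map (fiberι f b) (2 * p) A ∈ algebraicClasses (fiberOver f b) p := by
  -- the affine open `U` as an irreducible affine `ℂ`-scheme locally of finite type, `ι : U ⟶ S`
  haveI : IsOpenImmersion (openSubschemeOverι S U).left := inferInstanceAs (IsOpenImmersion U.ι)
  haveI hUaff : IsAffine (openSubschemeOver S U).left := hU
  haveI hUirr : IrreducibleSpace (openSubschemeOver S U).left := by
    change IrreducibleSpace U
    exact isIrreducible_iff_irreducibleSpace.mp ⟨⟨a.pt, haU⟩,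
      (PreirreducibleSpace.isPreirreducible_univ (X := S.left)).open_subset U.isOpen
        (Set.subset_univ _)⟩
  haveI hUlft : LocallyOfFiniteType (openSubschemeOver S U).hom := by
    change LocallyOfFiniteType (U.ι ≫ S.hom)
    infer_instance
  -- lift `a`, `b` to `U`
  have hrange : Set.range (AlgPoints.map (L := ℂ) (openSubschemeOverι S U)) = {P | P.pt ∈ U} := by
    rw [AlgPoints.range_map_of_isOpenImmersion_holds]
    ext P
    change P.pt ∈ U.ι.opensRange ↔ P.pt ∈ U
    rw [Scheme.Opens.opensRange_ι]
  obtain ⟨a', rfl⟩ : a ∈ Set.range (AlgPoints.map (L := ℂ) (openSubschemeOverι S U)) := by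
    rw [hrange]; exact haU
  obtain ⟨b', rfl⟩ : b ∈ Set.range (AlgPoints.map (L := ℂ) (openSubschemeOverι S U)) := by
    rw [hrange]; exact hbU
  by_cases hab : a' = b'
  · exact hab ▸ ha
  -- a smooth irreducible affine curve through `a'`, `b'` (Mumford), and transport along it
  obtain ⟨C, g, t₀, t, hCaff, hCirr, hCsm, hCdim, ht₀, ht⟩ :=
    mumford_smoothCurve_through_two_points_holds.of_irreducibleSpace a' b' hab
  refine variationalHodge_conclusion_of_baseChange f hf (g ≫ openSubschemeOverι S U) A hA
    (t₀ := t₀) (t := t) (by rw [AlgPoints.map_comp_apply, ht₀]) (by rw [AlgPoints.map_comp_apply, ht])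
    (fun hA' ht₀' => hV (familyPullback.snd f (g ≫ openSubschemeOverι S U))
      (hf.familyPullback_snd _) hCirr hCsm p _ hA' ⟨t₀, ht₀'⟩ t) ha

/-! ### The crux over irreducible bases locally of finite type -/

/-- **Granted the crux, its conclusion holds over every IRREDUCIBLE base locally of finite type over `ℂ`**
(no smoothness, normality, reducedness or separatedness of `S`): chain the anchor to the target through
affine opens (`forall_complexPoints_of_affineOpens`) and apply `variationalHodge_step_of_irreducibleBase`
in each. -/
theorem variationalHodge_conclusion_of_irreducibleBase (hV : VariationalHodge) ⦃n : ℕ⦄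
    ⦃𝒳 S : SchemeOver ℂ⦄ (f : 𝒳 ⟶ S) (hf : IsSmoothProjectiveFamily f n) (hirr : IrreducibleSpace S.left)
    (hlft : LocallyOfFiniteType S.hom) (p : ℕ) (A : complexBetti 𝒳 (2 * p))
    (hA : ∀ s : ComplexPoints S, IsRationalClass (complexBetti.map (fiberι f s) (2 * p) A) ∧
      IsOfHodgeType n (fiberOver f s) (2 * p) p p (complexBetti.map (fiberι f s) (2 * p) A))
    (hs₀ : ∃ s₀ : ComplexPoints S,
      complexBetti.map (fiberι f s₀) (2 * p) A ∈ algebraicClasses (fiberOver f s₀) p)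
    (s : ComplexPoints S) :
    complexBetti.map (fiberι f s) (2 * p) A ∈ algebraicClasses (fiberOver f s) p := by
  obtain ⟨s₀, hs₀⟩ := hs₀
  haveI := hirr
  haveI := hlft
  exact forall_complexPoints_of_affineOpens
    (fun t => complexBetti.map (fiberι f t) (2 * p) A ∈ algebraicClasses (fiberOver f t) p)
    (fun U hU a b haU hbU ha => variationalHodge_step_of_irreducibleBase hV f hf p A hA U hU a b haU hbU ha)
    hs₀ s

/-- **The smoothness of the base is an idle hypothesis of the crux**: `AnchorTransport.VariationalHodge`
is equivalent to the same statement with `AlgebraicGeometry.Smooth S.hom` replaced by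
`AlgebraicGeometry.LocallyOfFiniteType S.hom` — Grothendieck's variational Hodge statement for smooth
projective families over ALL irreducible complex bases locally of finite type. (`→`:
`variationalHodge_conclusion_of_irreducibleBase`; `←`: a smooth `S → Spec ℂ` is locally of finite type.) -/
theorem variationalHodge_iff_irreducibleBase :
    VariationalHodge ↔
      ∀ ⦃n : ℕ⦄ ⦃𝒳 S : SchemeOver ℂ⦄ (f : 𝒳 ⟶ S), IsSmoothProjectiveFamily f n →
        IrreducibleSpace S.left → LocallyOfFiniteType S.hom →
        ∀ (p : ℕ) (A : complexBetti 𝒳 (2 * p)),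
        (∀ s : ComplexPoints S, IsRationalClass (complexBetti.map (fiberι f s) (2 * p) A) ∧
          IsOfHodgeType n (fiberOver f s) (2 * p) p p (complexBetti.map (fiberι f s) (2 * p) A)) →
        (∃ s₀ : ComplexPoints S,
          complexBetti.map (fiberι f s₀) (2 * p) A ∈ algebraicClasses (fiberOver f s₀) p) →
        ∀ s : ComplexPoints S,
          complexBetti.map (fiberι f s) (2 * p) A ∈ algebraicClasses (fiberOver f s) p := by
  refine ⟨fun hV n 𝒳 S f hf hirr hlft p A hA hs₀ s =>
    variationalHodge_conclusion_of_irreducibleBase hV f hf hirr hlft p A hA hs₀ s,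
    fun h n 𝒳 S f hf hirr hsm p A hA hs₀ s => ?_⟩
  haveI := hsm
  exact h f hf hirr inferInstance p A hA hs₀ s

/-! ### Irreducibility weakens to connectedness -/

/-- **Transfer inside an irreducible closed subset of the base.** Granted the crux, for a smooth
projective family over a `ℂ`-scheme `S` locally of finite type, a fibrewise rational `(p,p)` global
class `A`, and a closed irreducible subset `Z ⊆ S`: if `A` is algebraic on the fibre over ONE complex
point of `Z`, it is algebraic on the fibre over EVERY complex point of `Z`. Pull the family back to the
reduced closed subscheme `V(𝒥_Z) ↪ S` (Mathlib `Scheme.IdealSheafData.vanishingIdeal … |>.subscheme`;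
irreducible, with generic point the generic point of `Z`; locally of finite type), lift the two complex
points to it (`AlgPoints.liftClosed`: `Spec ℂ` is reduced), and apply
`variationalHodge_conclusion_of_irreducibleBase` there (transport by
`variationalHodge_conclusion_of_baseChange`). -/
theorem variationalHodge_conclusion_of_isIrreducible_isClosed (hV : VariationalHodge) {n : ℕ}
    {𝒳 S : SchemeOver ℂ} (f : 𝒳 ⟶ S) (hf : IsSmoothProjectiveFamily f n) [LocallyOfFiniteType S.hom]
    (p : ℕ) (A : complexBetti 𝒳 (2 * p))
    (hA : ∀ s : ComplexPoints S, IsRationalClass (complexBetti.map (fiberι f s) (2 * p) A) ∧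
      IsOfHodgeType n (fiberOver f s) (2 * p) p p (complexBetti.map (fiberι f s) (2 * p) A))
    (Z : Set S.left) (hZc : IsClosed Z) (hZi : IsIrreducible Z) {w t : ComplexPoints S}
    (hw : w.pt ∈ Z) (ht : t.pt ∈ Z)
    (hwalg : complexBetti.map (fiberι f w) (2 * p) A ∈ algebraicClasses (fiberOver f w) p) :
    complexBetti.map (fiberι f t) (2 * p) A ∈ algebraicClasses (fiberOver f t) p := by
  -- the reduced closed subscheme `Y = V(𝒥_Z)` of `S`, `ι : Y ⟶ S`, with `range ι = Z`
  let Zc : Closeds S.left := ⟨Z, hZc⟩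
  let I : S.left.IdealSheafData := Scheme.IdealSheafData.vanishingIdeal Zc
  let Y : SchemeOver ℂ := Over.mk (I.subschemeι ≫ S.hom)
  let ι : Y ⟶ S := Over.homMk I.subschemeι rfl
  have hrange : Set.range ι.left.base = Z := by
    change Set.range I.subschemeι.base = Z
    rw [Scheme.IdealSheafData.range_subschemeι, Scheme.IdealSheafData.coe_support_vanishingIdeal]
    rfl
  haveI : IsClosedImmersion ι.left := inferInstanceAs (IsClosedImmersion I.subschemeι)
  haveI : LocallyOfFiniteType Y.hom := by
    change LocallyOfFiniteType (I.subschemeι ≫ S.hom)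
    infer_instance
  -- `Y` is irreducible: its point over the generic point of `Z` is a generic point of `Y`
  obtain ⟨y₀, hy₀⟩ : hZi.genericPoint ∈ Set.range ι.left.base := by
    rw [hrange]
    exact (hZi.isGenericPoint_genericPoint hZc).mem
  have hcl : closure ({y₀} : Set Y.left) = Set.univ := by
    rw [ι.left.isClosedEmbedding.isInducing.closure_eq_preimage_closure_image, Set.image_singleton,
      hy₀, hZi.closure_genericPoint hZc, ← hrange, Set.preimage_range]
  haveI hYirr : IrreducibleSpace Y.left :=
    (irreducibleSpace_def _).2 (IsGenericPoint.isIrreducible (S := Set.univ) hcl)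
  -- lift `w`, `t` to `Y` and transport along the base change by `ι`
  have hw' : w.pt ∈ Set.range ι.left := by rw [hrange]; exact hw
  have ht' : t.pt ∈ Set.range ι.left := by rw [hrange]; exact ht
  exact variationalHodge_conclusion_of_baseChange f hf ι A hA (AlgPoints.map_liftClosed ι w hw')
    (AlgPoints.map_liftClosed ι t ht')
    (fun hA' hw'' => variationalHodge_conclusion_of_irreducibleBase hV (familyPullback.snd f ι)
      (hf.familyPullback_snd ι) hYirr inferInstance p _ hA' ⟨_, hw''⟩ _) hwalg

/-- **Granted the crux, its conclusion holds over every CONNECTED base locally of finite type over `ℂ`**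
(irreducibility of `S` weakened to (pre)connectedness; no smoothness). Let `G ⊆ S` be the set of scheme
points `x` such that `A` is algebraic over some complex point of `\overline{\{x\}}`. By
`variationalHodge_conclusion_of_isIrreducible_isClosed`, membership in `G` passes between two points of
a common irreducible closed subset; every point `x` has a neighbourhood all of whose points share an
irreducible component with `x` (an affine open neighbourhood is a noetherian space — `S` is locally
noetherian — so its finitely many irreducible components not through `x` can be removed); hence
membership in `G` is locally constant, so constant on the preconnected `S`
(Mathlib `PreconnectedSpace.induction₂'`); the anchor puts `pt s₀` in `G`, and the target follows by one
more transfer inside `\overline{\{pt s\}}`. -/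
theorem variationalHodge_conclusion_of_preconnectedBase (hV : VariationalHodge) ⦃n : ℕ⦄
    ⦃𝒳 S : SchemeOver ℂ⦄ (f : 𝒳 ⟶ S) (hf : IsSmoothProjectiveFamily f n)
    (hconn : PreconnectedSpace S.left) (hlft : LocallyOfFiniteType S.hom) (p : ℕ)
    (A : complexBetti 𝒳 (2 * p))
    (hA : ∀ s : ComplexPoints S, IsRationalClass (complexBetti.map (fiberι f s) (2 * p) A) ∧
      IsOfHodgeType n (fiberOver f s) (2 * p) p p (complexBetti.map (fiberι f s) (2 * p) A))
    (hs₀ : ∃ s₀ : ComplexPoints S,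
      complexBetti.map (fiberι f s₀) (2 * p) A ∈ algebraicClasses (fiberOver f s₀) p)
    (s : ComplexPoints S) :
    complexBetti.map (fiberι f s) (2 * p) A ∈ algebraicClasses (fiberOver f s) p := by
  obtain ⟨s₀, hs₀⟩ := hs₀
  haveI := hconn
  haveI := hlft
  haveI : JacobsonSpace S.left := LocallyOfFiniteType.jacobsonSpace S.hom
  haveI : IsLocallyNoetherian S.left := LocallyOfFiniteType.isLocallyNoetherian S.hom
  -- the set `G` of scheme points over whose closure `A` is somewhere algebraic
  let G : Set S.left := {x | ∃ c : ComplexPoints S, c.pt ∈ closure ({x} : Set S.left) ∧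
    complexBetti.map (fiberι f c) (2 * p) A ∈ algebraicClasses (fiberOver f c) p}
  -- every `closure {x}` carries a complex point (Jacobson)
  have hpt : ∀ x : S.left, ∃ c : ComplexPoints S, c.pt ∈ closure ({x} : Set S.left) := fun x => by
    obtain ⟨y, hy, hyc⟩ := nonempty_inter_closedPoints
      (⟨x, subset_closure (Set.mem_singleton x)⟩ : (closure ({x} : Set S.left)).Nonempty)
      isClosed_closure.isLocallyClosed
    obtain ⟨c, rfl⟩ := EsnaultLevineViehweg.exists_algPoints_pt_eq (X := S) (k := ℂ) hyc
    exact ⟨c, hy⟩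
  -- membership in `G` passes between points of a common irreducible closed subset
  have hZ : ∀ Z : Set S.left, IsClosed Z → IsIrreducible Z → ∀ x y : S.left, x ∈ Z → y ∈ Z →
      x ∈ G → y ∈ G := by
    rintro Z hZc hZi x y hx hy ⟨c, hc, hcg⟩
    obtain ⟨d, hd⟩ := hpt y
    have hcZ : c.pt ∈ Z := (hZc.closure_subset_iff.2 (Set.singleton_subset_iff.2 hx)) hc
    have hdZ : d.pt ∈ Z := (hZc.closure_subset_iff.2 (Set.singleton_subset_iff.2 hy)) hd
    exact ⟨d, hd, variationalHodge_conclusion_of_isIrreducible_isClosed hV f hf p A hA Z hZc hZi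
      hcZ hdZ hcg⟩
  -- membership in `G` is locally constant
  have hloc : ∀ x : S.left, ∀ᶠ y in nhds x, (x ∈ G ↔ y ∈ G) := by
    intro x
    obtain ⟨U, hU, hxU, -⟩ := exists_isAffineOpen_mem_and_subset (U := ⊤) (x := x) trivial
    haveI : IsNoetherianRing Γ(S.left, U) := IsLocallyNoetherian.component_noetherian ⟨U, hU⟩
    haveI : NoetherianSpace U := noetherianSpace_of_isAffineOpen U hU
    -- the irreducible components of `U` not through `x`, a closed subset of `U` missing `x`
    let T : Set (Set U) := {C | C ∈ irreducibleComponents U ∧ (⟨x, hxU⟩ : U) ∉ C}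
    have hTfin : T.Finite := NoetherianSpace.finite_irreducibleComponents.subset fun C hC => hC.1
    have hFc : IsClosed (⋃ C ∈ T, C) :=
      hTfin.isClosed_biUnion fun C hC => isClosed_of_mem_irreducibleComponents C hC.1
    have hxF : (⟨x, hxU⟩ : U) ∉ ⋃ C ∈ T, C := by
      intro hx
      obtain ⟨C, hC, hxC⟩ := Set.mem_iUnion₂.1 hx
      exact hC.2 hxC
    have hVx : (Subtype.val '' (⋃ C ∈ T, C)ᶜ : Set S.left) ∈ nhds x :=
      (U.isOpen.isOpenMap_subtype_val _ hFc.isOpen_compl).mem_nhds ⟨⟨x, hxU⟩, hxF, rfl⟩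
    filter_upwards [hVx]
    rintro _ ⟨⟨y, hyU⟩, hyF, rfl⟩
    -- the irreducible component of `y` in `U` passes through `x`
    have hxC : (⟨x, hxU⟩ : U) ∈ irreducibleComponent (⟨y, hyU⟩ : U) := by
      by_contra hxC
      exact hyF (Set.mem_iUnion₂.2 ⟨irreducibleComponent (⟨y, hyU⟩ : U),
        ⟨irreducibleComponent_mem_irreducibleComponents _, hxC⟩, mem_irreducibleComponent⟩)
    -- its closure in `S` is an irreducible closed subset through `x` and `y`
    have hZi : IsIrreducible (closure (Subtype.val '' irreducibleComponent (⟨y, hyU⟩ : U))) :=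
      (isIrreducible_irreducibleComponent.image _ continuous_subtype_val.continuousOn).closure
    have hxZ : x ∈ closure (Subtype.val '' irreducibleComponent (⟨y, hyU⟩ : U)) :=
      subset_closure ⟨_, hxC, rfl⟩
    have hyZ : y ∈ closure (Subtype.val '' irreducibleComponent (⟨y, hyU⟩ : U)) :=
      subset_closure ⟨_, mem_irreducibleComponent, rfl⟩
    exact ⟨hZ _ isClosed_closure hZi x y hxZ hyZ, hZ _ isClosed_closure hZi y x hyZ hxZ⟩
  -- hence constant on the preconnected base
  have hall : ∀ x y : S.left, (x ∈ G ↔ y ∈ G) :=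
    PreconnectedSpace.induction₂' (fun x y => (x ∈ G ↔ y ∈ G))
      (fun x => by
        filter_upwards [hloc x] with y hy
        exact ⟨hy, hy.symm⟩)
      ⟨fun _ _ _ h₁ h₂ => h₁.trans h₂⟩
  -- the anchor puts `pt s₀` in `G`; conclude at `s` inside the irreducible closed set `closure {pt s}`
  obtain ⟨c, hc, hcg⟩ := (hall s₀.pt s.pt).1 ⟨s₀, subset_closure (Set.mem_singleton _), hs₀⟩
  exact variationalHodge_conclusion_of_isIrreducible_isClosed hV f hf p A hA (closure {s.pt})
    isClosed_closure isIrreducible_singleton.closure hc (subset_closure (Set.mem_singleton _)) hcg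

/-- **Both base hypotheses of the crux are idle up to connectedness**: `AnchorTransport.VariationalHodge`
is equivalent to Grothendieck's variational Hodge statement for smooth projective families over ALL
(pre)connected complex bases locally of finite type — `IrreducibleSpace S.left` weakened to
`PreconnectedSpace S.left` and `Smooth S.hom` to `LocallyOfFiniteType S.hom`. (Over a disconnected base
the statement is the Hodge conjecture itself: `Cruxes/VariationalHodge/Disproof.lean`,
`withoutBaseHyps`.) -/
theorem variationalHodge_iff_connectedBase :
    VariationalHodge ↔
      ∀ ⦃n : ℕ⦄ ⦃𝒳 S : SchemeOver ℂ⦄ (f : 𝒳 ⟶ S), IsSmoothProjectiveFamily f n →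
        PreconnectedSpace S.left → LocallyOfFiniteType S.hom →
        ∀ (p : ℕ) (A : complexBetti 𝒳 (2 * p)),
        (∀ s : ComplexPoints S, IsRationalClass (complexBetti.map (fiberι f s) (2 * p) A) ∧
          IsOfHodgeType n (fiberOver f s) (2 * p) p p (complexBetti.map (fiberι f s) (2 * p) A)) →
        (∃ s₀ : ComplexPoints S,
          complexBetti.map (fiberι f s₀) (2 * p) A ∈ algebraicClasses (fiberOver f s₀) p) →
        ∀ s : ComplexPoints S,
          complexBetti.map (fiberι f s) (2 * p) A ∈ algebraicClasses (fiberOver f s) p := by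
  refine ⟨fun hV n 𝒳 S f hf hconn hlft p A hA hs₀ s =>
    variationalHodge_conclusion_of_preconnectedBase hV f hf hconn hlft p A hA hs₀ s,
    fun h n 𝒳 S f hf hirr hsm p A hA hs₀ s => ?_⟩
  haveI := hirr
  haveI := hsm
  exact h f hf inferInstance inferInstance p A hA hs₀ s

/-! ### The route's assembly with anchors over connected (possibly singular, reducible) bases -/

/-- **`HodgeConjecture` from the crux and ANCHORS OVER CONNECTED BASES.** Granted
`AnchorTransport.VariationalHodge`, the Hodge conjecture follows as soon as every rational `(p,p)` class
`c` on a smooth projective `X` is, up to an isomorphism `X ≅ 𝒳_{s₁}`, the value at `s₁` of a fibrewise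
rational-`(p,p)` global class `A` on a smooth projective family `𝒳 ⟶ S` over a (PRE)CONNECTED base
LOCALLY OF FINITE TYPE (neither irreducible nor smooth: e.g. a connected union of components of a Hodge
locus, reduced, as it comes) with `A|_{𝒳_{s₀}}` algebraic at some anchor `s₀` — the route's
`AnchorExistence` with `IrreducibleSpace S.left` weakened to `PreconnectedSpace S.left` and `Smooth S.hom`
to `LocallyOfFiniteType S.hom`. Assembly as in the route's deciding theorem `closes`, through
`variationalHodge_conclusion_of_preconnectedBase`, the closed support items `IsoInvariance_holds` and
`HodgeModels_holds`, and `hodgeConjectureFor_iff_of_isSmoothProjective`. -/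
theorem hodgeConjecture_of_variationalHodge_of_anchors_over_connectedBases (hV : VariationalHodge)
    (hAn : ∀ ⦃n : ℕ⦄ ⦃X : SchemeOver ℂ⦄, IsSmoothProjective n X →
      ∀ (p : ℕ) (c : complexBetti X (2 * p)), IsRationalClass c → IsOfHodgeType n X (2 * p) p p c →
      ∃ (𝒳 S : SchemeOver ℂ) (f : 𝒳 ⟶ S) (s₁ s₀ : ComplexPoints S) (e : X ≅ fiberOver f s₁)
        (A : complexBetti 𝒳 (2 * p)),
        IsSmoothProjectiveFamily f n ∧ PreconnectedSpace S.left ∧ LocallyOfFiniteType S.hom ∧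
        (∀ s : ComplexPoints S, IsRationalClass (complexBetti.map (fiberι f s) (2 * p) A) ∧
          IsOfHodgeType n (fiberOver f s) (2 * p) p p (complexBetti.map (fiberι f s) (2 * p) A)) ∧
        complexBetti.map e.hom (2 * p) (complexBetti.map (fiberι f s₁) (2 * p) A) = c ∧
        complexBetti.map (fiberι f s₀) (2 * p) A ∈ algebraicClasses (fiberOver f s₀) p) :
    _root_.HodgeConjecture := by
  intro n X hX
  refine (hodgeConjectureFor_iff_of_isSmoothProjective (HodgeModels_holds n X) hX).2 ?_
  intro p c hc hpp
  obtain ⟨𝒳, S, f, s₁, s₀, e, A, hf, hconn, hlft, hfib, hAc, hs₀⟩ := hAn hX p c hc hpp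
  -- transport algebraicity from the anchor fibre `s₀` to the fibre `s₁` over the connected base …
  have h₁ := variationalHodge_conclusion_of_preconnectedBase hV f hf hconn hlft p A hfib ⟨s₀, hs₀⟩ s₁
  -- … and across the isomorphism `e : X ≅ 𝒳_{s₁}`
  have h₂ := IsoInvariance_holds e p _ h₁
  rw [hAc] at h₂
  exact h₂

/-- **`HodgeConjecture` from the crux and ANCHORS OVER IRREDUCIBLE BASES** — the route's
`AnchorExistence` with only `Smooth S.hom` weakened to `LocallyOfFiniteType S.hom` (irreducible bases,
any singularities): the special case of
`hodgeConjecture_of_variationalHodge_of_anchors_over_connectedBases` (an irreducible space is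
preconnected). -/
theorem hodgeConjecture_of_variationalHodge_of_anchors_over_irreducibleBases (hV : VariationalHodge)
    (hAn : ∀ ⦃n : ℕ⦄ ⦃X : SchemeOver ℂ⦄, IsSmoothProjective n X →
      ∀ (p : ℕ) (c : complexBetti X (2 * p)), IsRationalClass c → IsOfHodgeType n X (2 * p) p p c →
      ∃ (𝒳 S : SchemeOver ℂ) (f : 𝒳 ⟶ S) (s₁ s₀ : ComplexPoints S) (e : X ≅ fiberOver f s₁)
        (A : complexBetti 𝒳 (2 * p)),
        IsSmoothProjectiveFamily f n ∧ IrreducibleSpace S.left ∧ LocallyOfFiniteType S.hom ∧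
        (∀ s : ComplexPoints S, IsRationalClass (complexBetti.map (fiberι f s) (2 * p) A) ∧
          IsOfHodgeType n (fiberOver f s) (2 * p) p p (complexBetti.map (fiberι f s) (2 * p) A)) ∧
        complexBetti.map e.hom (2 * p) (complexBetti.map (fiberι f s₁) (2 * p) A) = c ∧
        complexBetti.map (fiberι f s₀) (2 * p) A ∈ algebraicClasses (fiberOver f s₀) p) :
    _root_.HodgeConjecture := by
  refine hodgeConjecture_of_variationalHodge_of_anchors_over_connectedBases hV
    fun n X hX p c hc hpp => ?_
  obtain ⟨𝒳, S, f, s₁, s₀, e, A, hf, hirr, hlft, hfib, hAc, hs₀⟩ := hAn hX p c hc hpp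
  haveI := hirr
  exact ⟨𝒳, S, f, s₁, s₀, e, A, hf, inferInstance, hlft, hfib, hAc, hs₀⟩

end Summit.HodgeConjecture.HodgeConjecture.Theorems

end
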